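import Literature.Analysis.FluidPDE.ElgindiThetaDerivativeOperator
import Literature.Analysis.FluidPDE.ElgindiHardyL12
import Literature.Analysis.FluidPDE.ElgindiAngularSingularIntegral
import HarnessLib

/-!
# Coercivity of `𝓛_Γ^T` with one `θ`-derivative ([Elgindi2021] Proposition 6.5)

Topic `Literature/Analysis/FluidPDE`. Proof file (everything proved, no definitions, no named
facts) on the proof path of the named fact
`Literature.Analysis.FluidPDE.Elgindi.ElgindiGhoulMasmoudi2021_stabilityCore`
(`ElgindiStabilityDecomposition.lean`), completing the proof of T. M. Elgindi, Ann. of Math. 194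
(2021) = arXiv:1904.04795 (`[Elgindi2021]`), §6.1 **Proposition 6.5** (p. 16 of the held text):

> `((D_θ𝓛_Γ^T(f)), (D_θf)w²/sin(2θ)^γ)_{L²} ≥ (¼ − α)|(D_θf)w/√(sin(2θ)^γ)|²_{L²} − 10⁷α|fw|²_{L²}`.

Printed proof (after the commutation formula and `∫sin(2θ)^{−γ}|D_θΓ|² ≤ 10α`, see
`ElgindiThetaDerivativeOperator.lean`, `ElgindiAngularSingularIntegral.lean`): "Consequently, if we
multiply `D_θ𝓛_Γ^T(f)` by `w²(1/sin(2θ)^γ)D_θf` and integrate, we get: `≥ ½|(D_θf)w/√(sin^γ)|² −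
10³√α|fw||(D_θf)w/√(sin^γ)| + (3/2)(∂_θ(sin(2θ)^{−α/10}), (w²/(1+z))(D_θf)²)`. The third term comes
from integrating the transport term by parts. Thus, `≥ (¼ − α)|(D_θf)w/√(sin^γ)|² −
2×10⁴α|fw|²`." (Remark 6.6 explains the idea.)

## The vendored proof

With `g = D_θf`, `ρ = sin(2θ)^{−γ}`, `Y = ∬(gw)²ρ`, `A = ∬(fw)²`, `D_θΓ = (2α/3)(1−3sin²θ)Γ`,
`ℓ₀ = L₁₂((3/(1+z))g)(0)`, the pairing is `T₁ − T₂ − T₄ + ℓ₀J₃` (`Dθ_opLΓT`) with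
`T₁ = ½Y` (`integral_opL_Dθ_energy`), `−T₄ ≥ −(3α/10)Y` (`integral_transport_Dθ_ge`), and, by the
square-root-free Cauchy–Schwarz inequality on the strip (`sq_integral_mul_le`) and Fubini,
`T₂² ≤ Y·(4/c²)(∫L₁₂(f)²/z²)(∫D_θΓ²ρ) ≤ 148αAY` (Hardy `∫L₁₂(f)²/z² ≤ (9π/8)A`, `∫D_θΓ²ρ ≤ 10α`,
`c ≥ 49/50`), `J₃² ≤ Y·(4/c²)(∫₀^∞(1+z)⁻²)(∫D_θΓ²ρ) ≤ 42αY`, and `ℓ₀² ≤ 153A` (integration by parts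
in `θ`: `ℓ₀ = −∬(K sin2θ)'·3f/((1+z)z)`, `|(K sin 2θ)'| ≤ 18`, `∫₀^∞z²/(1+z)⁶ = 1/30`). From
`T² ≤ καAY` one gets `|T| ≤ ⅛Y + 2καA`, whence the pairing is
`≥ (½ − ¼ − 3α/10)Y − 2(148 + 6426)αA ≥ (¼ − α)Y − 10⁷αA`. Proved for `0 < α ≤ 1/200` and
`f ∈ C²` compactly supported inside the open strip with `L₁₂(f)(0) = 0` (used for the Hardy step).
-/

noncomputable section

open MeasureTheory Set Function Real Filter
open _root_.Topology

namespace Literature.Analysis.FluidPDE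

namespace Elgindi

/-! ### Small facts on the weights -/

/-- `(sin(2θ)^{−γ/2})² = sin(2θ)^{−γ}` on the open quarter. [folklore] -/
theorem rpow_half_sq {s e : ℝ} (hs : 0 < s) : (s ^ (-e / 2)) ^ 2 = s ^ (-e) := by
  rw [← Real.rpow_two, ← Real.rpow_mul hs.le]
  ring_nf

/-- On `(0, π/2)` the explicit `D_θΓ` is `sin(2θ)Γ'`, so the singular angular integral controls
`∫(D_θΓ)²ρ`: `∫₀^{π/2}((2α/3)(1−3sin²θ)Γ)²sin(2θ)^{−γ} ≤ 10α` (`0 < α ≤ 1/200`). [folklore] -/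
theorem integral_sq_DθΓe_mul_rpow_le {α : ℝ} (hα : 0 < α) (hα' : α ≤ 1 / 200) :
    ∫ θ in Ioo 0 (π / 2), (2 * α / 3 * (1 - 3 * Real.sin θ ^ 2) * angularWeight α θ) ^ 2 *
        Real.sin (2 * θ) ^ (-gammaExp α) ≤ 10 * α := by
  have e : EqOn (fun θ => (Real.sin (2 * θ) * deriv (angularWeight α) θ) ^ 2 * Real.sin (2 * θ) ^ (-gammaExp α))
      (fun θ => (2 * α / 3 * (1 - 3 * Real.sin θ ^ 2) * angularWeight α θ) ^ 2 *
        Real.sin (2 * θ) ^ (-gammaExp α)) (Ioo 0 (π / 2)) := fun θ hθ => by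
    beta_reduce
    rw [sin_two_mul_mul_deriv_angularWeight α hθ]
  rw [← setIntegral_congr_fun measurableSet_Ioo e]
  exact integral_sq_Dθ_angularWeight_mul_rpow_le hα hα'

/-- Integrability of `(D_θΓ)²ρ` in the explicit form. [folklore] -/
theorem integrableOn_sq_DθΓe_mul_rpow {α : ℝ} (hα : 0 < α) (hα1 : α ≤ 1) :
    IntegrableOn (fun θ => (2 * α / 3 * (1 - 3 * Real.sin θ ^ 2) * angularWeight α θ) ^ 2 *
        Real.sin (2 * θ) ^ (-gammaExp α)) (Ioo 0 (π / 2)) :=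
  (integrableOn_sq_Dθ_angularWeight_mul_rpow hα hα1).congr_fun (fun θ hθ => by
    beta_reduce
    rw [sin_two_mul_mul_deriv_angularWeight α hθ]) measurableSet_Ioo

/-- `∫₀^∞ (1+z)⁻² dz = 1` and integrability. [folklore] -/
theorem integral_Ioi_inv_one_add_sq : ∫ z in Ioi (0 : ℝ), ((1 + z) ^ 2)⁻¹ = 1 := by
  have h := integral_Ioi_four_div_one_add_sq
  have e : ∫ z in Ioi (0 : ℝ), 4 / (1 + z) ^ 2 = 4 * ∫ z in Ioi (0 : ℝ), ((1 + z) ^ 2)⁻¹ := by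
    rw [← integral_const_mul]
    exact integral_congr_ae (Eventually.of_forall fun z => by simp [div_eq_mul_inv])
  rw [e] at h
  linarith

/-! ### Proposition 6.5: the pieces -/

section Prop65

variable {α : ℝ} (hα : 0 < α) (hα' : α ≤ 1 / 200) {f : ℝ → ℝ → ℝ} (hf : ContDiff ℝ 2 (uncurry f))
  (hs : HasCompactSupport (uncurry f)) (hsub : tsupport (uncurry f) ⊆ strip)

include hf hs hsub

/-- Integrability on the strip of `c·D_θf·w²·sin(2θ)^{−γ}` for `c` continuous on the strip. [folklore] -/
theorem integrableOn_mul_Dθ_weight {c : ℝ × ℝ → ℝ} (hc : ContinuousOn c strip) :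
    IntegrableOn (fun p : ℝ × ℝ => c p * Dθ f p.1 p.2 * radialWeight p.1 ^ 2 *
      Real.sin (2 * p.2) ^ (-gammaExp α)) strip := by
  have hgC : ContDiff ℝ 1 (uncurry (Dθ f)) := contDiff_Dθ (n := 1) hf hsub
  have hgs : HasCompactSupport (uncurry (Dθ f)) := hasCompactSupport_Dθ hs
  have hgsub : tsupport (uncurry (Dθ f)) ⊆ strip := tsupport_Dθ_subset.trans hsub
  have hg0 : ∀ p : ℝ × ℝ, p ∉ tsupport (uncurry (Dθ f)) → Dθ f p.1 p.2 = 0 := fun p hp =>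
    (image_eq_zero_of_notMem_tsupport hp : uncurry (Dθ f) p = 0)
  have hwon : ContinuousOn (fun p : ℝ × ℝ => radialWeight p.1) strip := by
    unfold radialWeight
    exact ContinuousOn.div (by fun_prop) (by fun_prop) fun p hp => pow_ne_zero 2 (ne_of_gt hp.1)
  have hρon : ContinuousOn (fun p : ℝ × ℝ => Real.sin (2 * p.2) ^ (-gammaExp α)) strip :=
    ((contDiffOn_sin_two_mul_rpow (-gammaExp α)).continuousOn).comp continuousOn_snd fun p hp => hp.2
  have hcont : Continuous fun p : ℝ × ℝ =>
      c p * Dθ f p.1 p.2 * radialWeight p.1 ^ 2 * Real.sin (2 * p.2) ^ (-gammaExp α) :=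
    continuous_of_continuousOn_strip (isClosed_tsupport _) hgsub
      (((hc.mul hgC.continuous.continuousOn).mul (hwon.pow 2)).mul hρon) fun p hp => by simp [hg0 p hp]
  exact (hcont.integrable_of_hasCompactSupport (HasCompactSupport.intro hgs fun p hp => by
    simp [hg0 p hp])).integrableOn

/-- **The angular Cauchy–Schwarz step, integrated**: `∫ (∫K f dθ)²/z² dz ≤ (9π/32)∬(fw)²`
(`(∫Kf)² ≤ (9π/32)∫f²`, Fubini, `1/z² ≤ w²`). [cite: Elgindi2021, §5 Lemma 5.4, proof (p. 15 of arXiv:1904.04795)] -/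
theorem integral_sq_kMoment_div_sq_le :
    ∫ z, 1 / z ^ 2 * kMoment f z ^ 2 ≤ 9 * π / 32 * ∫ p in strip, (f p.1 p.2 * radialWeight p.1) ^ 2 := by
  have hfc : Continuous (uncurry f) := hf.continuous
  obtain ⟨a, b, ha, -, hfab⟩ := exists_radial_bounds' hs hsub
  have hf0 : ∀ p : ℝ × ℝ, p ∉ tsupport (uncurry f) → f p.1 p.2 = 0 := fun p hp =>
    (image_eq_zero_of_notMem_tsupport hp : uncurry f p = 0)
  set F2 : ℝ → ℝ := fun z => ∫ θ in Ioo 0 (π / 2), f z θ ^ 2 with hF2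
  have hK : ∀ z, kMoment f z ^ 2 ≤ 9 * π / 32 * F2 z := fun z => sq_kMoment_le hfc z
  have hφ0 : ∀ z, z ∉ Icc a b → kMoment f z = 0 := by
    intro z hz
    refine kMoment_eq_zero_of_not_mem hfab ?_
    rcases not_and_or.1 (fun h => hz ⟨h.1, h.2⟩ : ¬(a ≤ z ∧ z ≤ b)) with h | h
    · exact Or.inl (not_le.1 h)
    · exact Or.inr (not_le.1 h)
  have hφa : ∀ z, z < a → kMoment f z = 0 := fun z hz => hφ0 z fun h => (not_le.2 hz) h.1
  have hF20 : ∀ z, z ∉ Icc a b → F2 z = 0 := by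
    intro z hz
    simp only [hF2]
    refine setIntegral_eq_zero_of_forall_eq_zero fun θ _ => ?_
    have : f z θ = 0 := by
      by_contra h
      exact hz ⟨(hfab z θ h).1, (hfab z θ h).2⟩
    simp [this]
  have hF2a : ∀ z, z < a → F2 z = 0 := fun z hz => hF20 z fun h => (not_le.2 hz) h.1
  have hF2c : Continuous F2 := by
    have e : F2 = fun z => ∫ θ in Icc 0 (π / 2), f z θ ^ 2 := by
      funext z; simp only [hF2]; rw [integral_Icc_eq_integral_Ioo]
    rw [e]
    exact continuous_parametric_integral_of_continuous
      (by fun_prop : Continuous (uncurry fun z θ => f z θ ^ 2)) isCompact_Icc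
  have hkc : Continuous (kMoment f) := continuous_kMoment hfc
  have hu2 : ContinuousOn (fun z : ℝ => 1 / z ^ 2) {0}ᶜ :=
    ContinuousOn.div continuousOn_const (continuousOn_id.pow 2) fun z hz => pow_ne_zero 2 hz
  have iφ : Integrable fun z => 1 / z ^ 2 * kMoment f z ^ 2 :=
    (continuous_mul_of_eq_zero_lt hu2 (hkc.pow 2) ha fun z hz => by
      simp [hφa z hz]).integrable_of_hasCompactSupport
      (HasCompactSupport.intro (isCompact_Icc : IsCompact (Icc a b)) fun z hz => by simp [hφ0 z hz])
  have iF : Integrable fun z => 1 / z ^ 2 * F2 z :=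
    (continuous_mul_of_eq_zero_lt hu2 hF2c ha fun z hz => hF2a z hz).integrable_of_hasCompactSupport
      (HasCompactSupport.intro (isCompact_Icc : IsCompact (Icc a b)) fun z hz => by simp [hF20 z hz])
  have c2 : ∫ z, 1 / z ^ 2 * kMoment f z ^ 2 ≤ 9 * π / 32 * ∫ z, 1 / z ^ 2 * F2 z := by
    rw [← integral_const_mul]
    refine integral_mono iφ (iF.const_mul _) fun z => ?_
    calc 1 / z ^ 2 * kMoment f z ^ 2 ≤ 1 / z ^ 2 * (9 * π / 32 * F2 z) :=
          mul_le_mul_of_nonneg_left (hK z) (by positivity)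
      _ = 9 * π / 32 * (1 / z ^ 2 * F2 z) := by ring
  -- `∫ F2/z² = ∬ f²/z² ≤ ∬ (fw)²`
  have hwon : ContinuousOn (fun p : ℝ × ℝ => radialWeight p.1) strip := by
    unfold radialWeight
    exact ContinuousOn.div (by fun_prop) (by fun_prop) fun p hp => pow_ne_zero 2 (ne_of_gt hp.1)
  have cWf : Continuous fun p : ℝ × ℝ => 1 / p.1 ^ 2 * f p.1 p.2 ^ 2 :=
    continuous_of_continuousOn_strip (isClosed_tsupport _) hsub
      ((hu2.comp continuousOn_fst fun p hp => (ne_of_gt hp.1 : p.1 ≠ 0)).mul (hfc.continuousOn.pow 2))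
      fun p hp => by simp [hf0 p hp]
  have iWf : Integrable fun p : ℝ × ℝ => 1 / p.1 ^ 2 * f p.1 p.2 ^ 2 :=
    cWf.integrable_of_hasCompactSupport (HasCompactSupport.intro hs fun p hp => by simp [hf0 p hp])
  have hiG : IntegrableOn (fun p : ℝ × ℝ => (f p.1 p.2 * radialWeight p.1) ^ 2) strip := by
    have e : (fun p : ℝ × ℝ => (f p.1 p.2 * radialWeight p.1) ^ 2) =
        fun p => f p.1 p.2 * (f p.1 p.2 * radialWeight p.1 ^ 2) := by funext p; ring
    rw [e]
    refine (Continuous.integrable_of_hasCompactSupport ?_ hs.mul_right).integrableOn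
    exact continuous_of_continuousOn_strip (isClosed_tsupport _) hsub
      (hfc.continuousOn.mul (hfc.continuousOn.mul (hwon.pow 2))) fun p hp => by simp [hf0 p hp]
  have hFub : ∫ z, 1 / z ^ 2 * F2 z = ∫ p in strip, 1 / p.1 ^ 2 * f p.1 p.2 ^ 2 := by
    rw [volume_restrict_strip,
      integral_prod _ (by rw [← volume_restrict_strip]; exact iWf.integrableOn),
      ← setIntegral_eq_integral_of_forall_compl_eq_zero (s := Ioi 0) (fun z hz => by
        rw [hF2a z (lt_of_le_of_lt (not_lt.1 hz) ha), mul_zero])]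
    refine integral_congr_ae (Eventually.of_forall fun z => ?_)
    simp only [hF2]
    rw [← integral_const_mul]
  have hmono : ∫ p in strip, 1 / p.1 ^ 2 * f p.1 p.2 ^ 2 ≤ ∫ p in strip, (f p.1 p.2 * radialWeight p.1) ^ 2 := by
    refine setIntegral_mono_on iWf.integrableOn hiG measurableSet_strip fun p hp => ?_
    have hz0 : (0 : ℝ) < p.1 := hp.1
    have hw : 1 / p.1 ^ 2 ≤ radialWeight p.1 ^ 2 := by
      have hw1 : 1 ≤ radialWeight p.1 := by
        unfold radialWeight
        rw [le_div_iff₀ (by positivity)]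
        nlinarith
      have hw2 : 1 / p.1 ^ 2 ≤ radialWeight p.1 := by
        unfold radialWeight
        exact div_le_div_of_nonneg_right (by nlinarith) (by positivity)
      calc 1 / p.1 ^ 2 = 1 / p.1 ^ 2 * 1 := by ring
        _ ≤ radialWeight p.1 * radialWeight p.1 := mul_le_mul hw2 hw1 (by norm_num) (by linarith)
        _ = radialWeight p.1 ^ 2 := by ring
    calc 1 / p.1 ^ 2 * f p.1 p.2 ^ 2 ≤ radialWeight p.1 ^ 2 * f p.1 p.2 ^ 2 :=
          mul_le_mul_of_nonneg_right hw (sq_nonneg _)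
      _ = (f p.1 p.2 * radialWeight p.1) ^ 2 := by ring
  calc ∫ z, 1 / z ^ 2 * kMoment f z ^ 2 ≤ 9 * π / 32 * ∫ z, 1 / z ^ 2 * F2 z := c2
    _ ≤ 9 * π / 32 * ∫ p in strip, (f p.1 p.2 * radialWeight p.1) ^ 2 := by
        rw [hFub]; nlinarith [hmono, pi_pos]

/-- **The Hardy step** `∫ L₁₂(f)²/z² dz ≤ (9π/8)∬(fw)²` (needs `L₁₂(f)(0) = 0`):
`∫L²/z² ≤ 4∫(∫Kf dθ)²/z² ≤ 4·(9π/32)∬(fw)²`. [cite: Elgindi2021, §5 Lemma 5.4, proof (p. 15 of arXiv:1904.04795)] -/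
theorem integral_sq_L12_div_sq_le (hL0 : L12 f 0 = 0) :
    ∫ z, 1 / z ^ 2 * L12 f z ^ 2 ≤ 9 * π / 8 * ∫ p in strip, (f p.1 p.2 * radialWeight p.1) ^ 2 := by
  have hfc : Continuous (uncurry f) := hf.continuous
  obtain ⟨a, b, ha, -, hfab⟩ := exists_radial_bounds' hs hsub
  set L : ℝ → ℝ := L12 f with hLdef
  set ψ : ℝ → ℝ := fun z => kMoment f z / z with hψ
  have hLa : ∀ z, z < a → L z = 0 := fun z hz => (L12_eq_L12_zero_of_le hfc ha hfab hz.le).trans hL0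
  have hLb : ∀ z, b < z → L z = 0 := fun z hz => L12_eq_zero_of_le hfc ha hfab hz.le
  have hLd : ∀ z, HasDerivAt L (-ψ z) z := hasDerivAt_L12 hfc hs hsub
  have hψc : Continuous ψ := continuous_kMoment_div hfc ha hfab
  have hLs : HasCompactSupport L := by
    refine HasCompactSupport.intro (isCompact_Icc (a := a) (b := b)) fun z hz => ?_
    rcases not_and_or.1 (fun h => hz ⟨h.1, h.2⟩ : ¬(a ≤ z ∧ z ≤ b)) with h | h
    · exact hLa z (not_le.1 h)
    · exact hLb z (not_le.1 h)
  have H2 := hardy_sq_div_sq_le hLd hψc.neg hLs ha hLa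
  have hφa : ∀ z, z < a → kMoment f z = 0 := fun z hz =>
    kMoment_eq_zero_of_not_mem hfab (Or.inl hz)
  have e : ∫ z, (-ψ z) ^ 2 = ∫ z, 1 / z ^ 2 * kMoment f z ^ 2 := by
    refine integral_congr_ae (Eventually.of_forall fun z => ?_)
    beta_reduce
    by_cases hz : z = 0
    · simp [hψ, hz]
    · simp only [hψ]; field_simp
  have hk := integral_sq_kMoment_div_sq_le hf hs hsub
  rw [e] at H2
  linarith

/-- **The `Γ'`-term against `L₁₂(f)`**: with `T₂ = ∬ (2z/(c(1+z)²))L₁₂(f)·D_θΓ·D_θf·w²ρ`,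
`T₂² ≤ 148·α·∬(fw)²·∬(D_θf·w)²ρ` (`0 < α ≤ 1/200`, `L₁₂(f)(0) = 0`). [cite: Elgindi2021, §6.1, proof of Proposition 6.5 (p. 16 of arXiv:1904.04795)] -/
theorem sq_T2_le (hα : 0 < α) (hα' : α ≤ 1 / 200) (hL0 : L12 f 0 = 0) :
    (∫ p in strip, 2 * p.1 / (profileConst α * (1 + p.1) ^ 2) * L12 f p.1 *
        (2 * α / 3 * (1 - 3 * Real.sin p.2 ^ 2) * angularWeight α p.2) *
        Dθ f p.1 p.2 * radialWeight p.1 ^ 2 * Real.sin (2 * p.2) ^ (-gammaExp α)) ^ 2 ≤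
      148 * α * (∫ p in strip, (f p.1 p.2 * radialWeight p.1) ^ 2) *
        ∫ p in strip, (Dθ f p.1 p.2 * radialWeight p.1) ^ 2 * Real.sin (2 * p.2) ^ (-gammaExp α) := by
  have hcpos : 0 < profileConst α := profileConst_pos hα.le
  have hc49 : (49 / 50 : ℝ) ≤ profileConst α := profileConst_ge hα.le hα'
  have hfc : Continuous (uncurry f) := hf.continuous
  obtain ⟨a, b, ha, -, hfab⟩ := exists_radial_bounds' hs hsub
  set L : ℝ → ℝ := L12 f with hLdef
  have hLa : ∀ z, z < a → L z = 0 := fun z hz => (L12_eq_L12_zero_of_le hfc ha hfab hz.le).trans hL0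
  have hLb : ∀ z, b < z → L z = 0 := fun z hz => L12_eq_zero_of_le hfc ha hfab hz.le
  have hLc : Continuous L := continuous_L12 hfc hs hsub
  set D : ℝ → ℝ := fun θ => 2 * α / 3 * (1 - 3 * Real.sin θ ^ 2) * angularWeight α θ with hD
  have hDc : Continuous D := by
    simp only [hD]
    exact ((continuous_const.mul (by fun_prop)).mul (continuous_angularWeight hα.le))
  set τ : ℝ → ℝ := fun θ => Real.sin (2 * θ) ^ (-gammaExp α / 2) with hτ
  set φ : ℝ × ℝ → ℝ := fun p => Dθ f p.1 p.2 * radialWeight p.1 * τ p.2 with hφ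
  set ψ : ℝ × ℝ → ℝ := fun p => 2 / (profileConst α * p.1) * L p.1 * D p.2 * τ p.2 with hψ
  -- the three integrands of Cauchy–Schwarz
  have hτ2 : ∀ p ∈ strip, τ p.2 ^ 2 = Real.sin (2 * p.2) ^ (-gammaExp α) := fun p hp =>
    rpow_half_sq (Real.sin_pos_of_pos_of_lt_pi (by linarith [hp.2.1]) (by linarith [hp.2.2]))
  have eφψ : ∀ p ∈ strip, φ p * ψ p = 2 * p.1 / (profileConst α * (1 + p.1) ^ 2) * L12 f p.1 * D p.2 *
      Dθ f p.1 p.2 * radialWeight p.1 ^ 2 * Real.sin (2 * p.2) ^ (-gammaExp α) := by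
    intro p hp
    have hz : (0 : ℝ) < p.1 := hp.1
    rw [← hτ2 p hp]
    simp only [hφ, hψ, hLdef]
    unfold radialWeight
    field_simp
  have eφ2 : ∀ p ∈ strip, φ p ^ 2 = (Dθ f p.1 p.2 * radialWeight p.1) ^ 2 * Real.sin (2 * p.2) ^ (-gammaExp α) := by
    intro p hp
    rw [← hτ2 p hp]
    simp only [hφ]
    ring
  have eψ2 : ∀ p ∈ strip, ψ p ^ 2 = (4 / profileConst α ^ 2 * (1 / p.1 ^ 2 * L p.1 ^ 2)) *
      (D p.2 ^ 2 * Real.sin (2 * p.2) ^ (-gammaExp α)) := by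
    intro p hp
    have hz : (0 : ℝ) < p.1 := hp.1
    rw [← hτ2 p hp]
    simp only [hψ]
    field_simp
    ring
  -- integrability
  have iφψ : IntegrableOn (fun p => φ p * ψ p) strip := by
    have hc : ContinuousOn (fun p : ℝ × ℝ => 2 * p.1 / (profileConst α * (1 + p.1) ^ 2) * L12 f p.1 * D p.2) strip := by
      refine ((ContinuousOn.div (by fun_prop) (by fun_prop) fun p hp => ?_).mul
        (hLc.comp continuous_fst).continuousOn).mul (hDc.comp continuous_snd).continuousOn
      have : (0 : ℝ) < p.1 := hp.1
      exact mul_ne_zero hcpos.ne' (by positivity)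
    exact (integrableOn_mul_Dθ_weight hf hs hsub hc).congr_fun (fun p hp => (eφψ p hp).symm) measurableSet_strip
  have iφ2 : IntegrableOn (fun p => φ p ^ 2) strip := by
    have h := integrableOn_mul_Dθ_weight (α := α) hf hs hsub (c := fun p : ℝ × ℝ => Dθ f p.1 p.2)
      (contDiff_Dθ (n := 1) hf hsub).continuous.continuousOn
    refine h.congr_fun (fun p hp => ?_) measurableSet_strip
    rw [eφ2 p hp]; ring
  have iz : Integrable (fun z : ℝ => 4 / profileConst α ^ 2 * (1 / z ^ 2 * L z ^ 2)) (volume.restrict (Ioi 0)) := by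
    have hu2 : ContinuousOn (fun z : ℝ => 1 / z ^ 2) {0}ᶜ :=
      ContinuousOn.div continuousOn_const (continuousOn_id.pow 2) fun z hz => pow_ne_zero 2 hz
    have hLs : HasCompactSupport L := by
      refine HasCompactSupport.intro (isCompact_Icc (a := a) (b := b)) fun z hz => ?_
      rcases not_and_or.1 (fun h => hz ⟨h.1, h.2⟩ : ¬(a ≤ z ∧ z ≤ b)) with h | h
      · exact hLa z (not_le.1 h)
      · exact hLb z (not_le.1 h)
    have h : Integrable (fun z : ℝ => 1 / z ^ 2 * L z ^ 2) :=
      (continuous_mul_of_eq_zero_lt hu2 (hLc.pow 2) ha fun z hz => by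
        simp [hLa z hz]).integrable_of_hasCompactSupport
        (HasCompactSupport.intro hLs fun z hz => by simp [image_eq_zero_of_notMem_tsupport hz])
    exact (h.const_mul _).integrableOn
  have iθ : Integrable (fun θ : ℝ => D θ ^ 2 * Real.sin (2 * θ) ^ (-gammaExp α))
      (volume.restrict (Ioo 0 (π / 2))) := integrableOn_sq_DθΓe_mul_rpow hα (by linarith)
  have iψ2 : IntegrableOn (fun p => ψ p ^ 2) strip := by
    have h := iz.mul_prod iθ
    rw [← volume_restrict_strip] at h
    exact IntegrableOn.congr_fun h (fun p hp => (eψ2 p hp).symm) measurableSet_strip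
  -- Cauchy–Schwarz and the evaluation of `∬ψ²`
  have hCS := sq_integral_mul_le iφ2 iψ2 iφψ
  have hψ2 : ∫ p in strip, ψ p ^ 2 = (4 / profileConst α ^ 2 * ∫ z in Ioi 0, 1 / z ^ 2 * L z ^ 2) *
      ∫ θ in Ioo 0 (π / 2), D θ ^ 2 * Real.sin (2 * θ) ^ (-gammaExp α) := by
    rw [setIntegral_congr_fun measurableSet_strip eψ2, volume_restrict_strip,
      integral_prod_mul (f := fun z : ℝ => 4 / profileConst α ^ 2 * (1 / z ^ 2 * L z ^ 2))
        (g := fun θ : ℝ => D θ ^ 2 * Real.sin (2 * θ) ^ (-gammaExp α)), integral_const_mul]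
  have hLz : ∫ z in Ioi 0, 1 / z ^ 2 * L z ^ 2 = ∫ z, 1 / z ^ 2 * L z ^ 2 := by
    refine setIntegral_eq_integral_of_forall_compl_eq_zero fun z hz => ?_
    rw [hLa z (lt_of_le_of_lt (not_lt.1 hz) ha)]; ring
  have hHardy := integral_sq_L12_div_sq_le hf hs hsub hL0
  have hAng := integral_sq_DθΓe_mul_rpow_le hα hα'
  set A : ℝ := ∫ p in strip, (f p.1 p.2 * radialWeight p.1) ^ 2 with hA
  set Y : ℝ := ∫ p in strip, (Dθ f p.1 p.2 * radialWeight p.1) ^ 2 * Real.sin (2 * p.2) ^ (-gammaExp α) with hY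
  have hA0 : 0 ≤ A := integral_nonneg fun p => sq_nonneg _
  have hY0 : 0 ≤ Y := by
    simp only [hY]
    rw [← setIntegral_congr_fun measurableSet_strip eφ2]
    exact integral_nonneg fun p => sq_nonneg _
  have hLz0 : 0 ≤ ∫ z, 1 / z ^ 2 * L z ^ 2 := integral_nonneg fun z => by positivity
  have hAng0 : 0 ≤ ∫ θ in Ioo 0 (π / 2), D θ ^ 2 * Real.sin (2 * θ) ^ (-gammaExp α) := by
    refine setIntegral_nonneg measurableSet_Ioo fun θ hθ => ?_
    have hsθ : 0 < Real.sin (2 * θ) := Real.sin_pos_of_pos_of_lt_pi (by linarith [hθ.1]) (by linarith [hθ.2])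
    exact mul_nonneg (sq_nonneg _) (Real.rpow_nonneg hsθ.le _)
  -- rewrite the pairing and assemble the numbers
  have eT : ∫ p in strip, 2 * p.1 / (profileConst α * (1 + p.1) ^ 2) * L12 f p.1 *
      (2 * α / 3 * (1 - 3 * Real.sin p.2 ^ 2) * angularWeight α p.2) *
      Dθ f p.1 p.2 * radialWeight p.1 ^ 2 * Real.sin (2 * p.2) ^ (-gammaExp α) = ∫ p in strip, φ p * ψ p :=
    (setIntegral_congr_fun measurableSet_strip eφψ).symm
  have eY : ∫ p in strip, φ p ^ 2 = Y := setIntegral_congr_fun measurableSet_strip eφ2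
  rw [eT]
  rw [eY, hψ2, hLz] at hCS
  have hc2 : 4 / profileConst α ^ 2 ≤ 4 / (49 / 50 : ℝ) ^ 2 := by
    apply div_le_div_of_nonneg_left (by norm_num) (by norm_num)
    exact pow_le_pow_left₀ (by norm_num) hc49 2
  have hπ := Real.pi_lt_d4
  -- `∬ψ² ≤ (4/0.98²)·(9π/8)A·10α ≤ 148 α A`
  have hψ2le : (4 / profileConst α ^ 2 * ∫ z, 1 / z ^ 2 * L z ^ 2) *
      ∫ θ in Ioo 0 (π / 2), D θ ^ 2 * Real.sin (2 * θ) ^ (-gammaExp α) ≤ 148 * α * A := by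
    have h1 : 4 / profileConst α ^ 2 * ∫ z, 1 / z ^ 2 * L z ^ 2 ≤ 4 / (49 / 50 : ℝ) ^ 2 * (9 * π / 8 * A) :=
      mul_le_mul hc2 hHardy hLz0 (by norm_num)
    have h1' : 0 ≤ 4 / profileConst α ^ 2 * ∫ z, 1 / z ^ 2 * L z ^ 2 := by positivity
    have hπαA : π * (α * A) ≤ 3.1416 * (α * A) := mul_le_mul_of_nonneg_right hπ.le (by positivity)
    calc (4 / profileConst α ^ 2 * ∫ z, 1 / z ^ 2 * L z ^ 2) *
          ∫ θ in Ioo 0 (π / 2), D θ ^ 2 * Real.sin (2 * θ) ^ (-gammaExp α)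
        ≤ (4 / (49 / 50 : ℝ) ^ 2 * (9 * π / 8 * A)) * (10 * α) := mul_le_mul h1 hAng hAng0 (by positivity)
      _ ≤ 148 * α * A := by nlinarith [hπαA, hA0, hα.le]
  calc (∫ p in strip, φ p * ψ p) ^ 2 ≤ Y * ((4 / profileConst α ^ 2 * ∫ z, 1 / z ^ 2 * L z ^ 2) *
        ∫ θ in Ioo 0 (π / 2), D θ ^ 2 * Real.sin (2 * θ) ^ (-gammaExp α)) := hCS
    _ ≤ Y * (148 * α * A) := mul_le_mul_of_nonneg_left hψ2le hY0
    _ = 148 * α * A * Y := by ring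

/-- **The `Γ'`-term of the projector**: `J₃ = ∬ (2z²/(1+z)³/c)·D_θΓ·D_θf·w²ρ` has
`J₃² ≤ 42·α·∬(D_θf·w)²ρ` (`0 < α ≤ 1/200`). [cite: Elgindi2021, §6.1, proof of Proposition 6.5 (p. 16 of arXiv:1904.04795)] -/
theorem sq_J3_le (hα : 0 < α) (hα' : α ≤ 1 / 200) :
    (∫ p in strip, 2 * p.1 ^ 2 / (1 + p.1) ^ 3 / profileConst α *
        (2 * α / 3 * (1 - 3 * Real.sin p.2 ^ 2) * angularWeight α p.2) *
        Dθ f p.1 p.2 * radialWeight p.1 ^ 2 * Real.sin (2 * p.2) ^ (-gammaExp α)) ^ 2 ≤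
      42 * α * ∫ p in strip, (Dθ f p.1 p.2 * radialWeight p.1) ^ 2 * Real.sin (2 * p.2) ^ (-gammaExp α) := by
  have hcpos : 0 < profileConst α := profileConst_pos hα.le
  have hc49 : (49 / 50 : ℝ) ≤ profileConst α := profileConst_ge hα.le hα'
  set D : ℝ → ℝ := fun θ => 2 * α / 3 * (1 - 3 * Real.sin θ ^ 2) * angularWeight α θ with hD
  have hDc : Continuous D := by
    simp only [hD]
    exact ((continuous_const.mul (by fun_prop)).mul (continuous_angularWeight hα.le))
  set τ : ℝ → ℝ := fun θ => Real.sin (2 * θ) ^ (-gammaExp α / 2) with hτ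
  set φ : ℝ × ℝ → ℝ := fun p => Dθ f p.1 p.2 * radialWeight p.1 * τ p.2 with hφ
  set ψ : ℝ × ℝ → ℝ := fun p => 2 / (profileConst α * (1 + p.1)) * D p.2 * τ p.2 with hψ
  have hτ2 : ∀ p ∈ strip, τ p.2 ^ 2 = Real.sin (2 * p.2) ^ (-gammaExp α) := fun p hp =>
    rpow_half_sq (Real.sin_pos_of_pos_of_lt_pi (by linarith [hp.2.1]) (by linarith [hp.2.2]))
  have eφψ : ∀ p ∈ strip, φ p * ψ p = 2 * p.1 ^ 2 / (1 + p.1) ^ 3 / profileConst α * D p.2 *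
      Dθ f p.1 p.2 * radialWeight p.1 ^ 2 * Real.sin (2 * p.2) ^ (-gammaExp α) := by
    intro p hp
    have hz : (0 : ℝ) < p.1 := hp.1
    rw [← hτ2 p hp]
    simp only [hφ, hψ]
    unfold radialWeight
    field_simp
  have eφ2 : ∀ p ∈ strip, φ p ^ 2 = (Dθ f p.1 p.2 * radialWeight p.1) ^ 2 * Real.sin (2 * p.2) ^ (-gammaExp α) := by
    intro p hp
    rw [← hτ2 p hp]
    simp only [hφ]
    ring
  have eψ2 : ∀ p ∈ strip, ψ p ^ 2 = (4 / profileConst α ^ 2 * ((1 + p.1) ^ 2)⁻¹) *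
      (D p.2 ^ 2 * Real.sin (2 * p.2) ^ (-gammaExp α)) := by
    intro p hp
    have hz : (0 : ℝ) < p.1 := hp.1
    rw [← hτ2 p hp]
    simp only [hψ]
    field_simp
    ring
  have iφψ : IntegrableOn (fun p => φ p * ψ p) strip := by
    have hc : ContinuousOn (fun p : ℝ × ℝ => 2 * p.1 ^ 2 / (1 + p.1) ^ 3 / profileConst α * D p.2) strip := by
      refine (ContinuousOn.div_const (ContinuousOn.div (by fun_prop) (by fun_prop) fun p hp => ?_) _).mul
        (hDc.comp continuous_snd).continuousOn
      have : (0 : ℝ) < p.1 := hp.1; positivity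
    exact (integrableOn_mul_Dθ_weight hf hs hsub hc).congr_fun (fun p hp => (eφψ p hp).symm) measurableSet_strip
  have iφ2 : IntegrableOn (fun p => φ p ^ 2) strip := by
    have h := integrableOn_mul_Dθ_weight (α := α) hf hs hsub (c := fun p : ℝ × ℝ => Dθ f p.1 p.2)
      (contDiff_Dθ (n := 1) hf hsub).continuous.continuousOn
    refine h.congr_fun (fun p hp => ?_) measurableSet_strip
    rw [eφ2 p hp]; ring
  have iz : Integrable (fun z : ℝ => 4 / profileConst α ^ 2 * ((1 + z) ^ 2)⁻¹) (volume.restrict (Ioi 0)) :=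
    (integrableOn_inv_one_add_sq.const_mul _)
  have iθ : Integrable (fun θ : ℝ => D θ ^ 2 * Real.sin (2 * θ) ^ (-gammaExp α))
      (volume.restrict (Ioo 0 (π / 2))) := integrableOn_sq_DθΓe_mul_rpow hα (by linarith)
  have iψ2 : IntegrableOn (fun p => ψ p ^ 2) strip := by
    have h := iz.mul_prod iθ
    rw [← volume_restrict_strip] at h
    exact IntegrableOn.congr_fun h (fun p hp => (eψ2 p hp).symm) measurableSet_strip
  have hCS := sq_integral_mul_le iφ2 iψ2 iφψ
  have hψ2 : ∫ p in strip, ψ p ^ 2 = (4 / profileConst α ^ 2 * ∫ z in Ioi (0 : ℝ), ((1 + z) ^ 2)⁻¹) *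
      ∫ θ in Ioo 0 (π / 2), D θ ^ 2 * Real.sin (2 * θ) ^ (-gammaExp α) := by
    rw [setIntegral_congr_fun measurableSet_strip eψ2, volume_restrict_strip,
      integral_prod_mul (f := fun z : ℝ => 4 / profileConst α ^ 2 * ((1 + z) ^ 2)⁻¹)
        (g := fun θ : ℝ => D θ ^ 2 * Real.sin (2 * θ) ^ (-gammaExp α)), integral_const_mul]
  rw [integral_Ioi_inv_one_add_sq, mul_one] at hψ2
  have hAng := integral_sq_DθΓe_mul_rpow_le hα hα'
  set Y : ℝ := ∫ p in strip, (Dθ f p.1 p.2 * radialWeight p.1) ^ 2 * Real.sin (2 * p.2) ^ (-gammaExp α) with hY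
  have hY0 : 0 ≤ Y := by
    simp only [hY]
    rw [← setIntegral_congr_fun measurableSet_strip eφ2]
    exact integral_nonneg fun p => sq_nonneg _
  have hAng0 : 0 ≤ ∫ θ in Ioo 0 (π / 2), D θ ^ 2 * Real.sin (2 * θ) ^ (-gammaExp α) := by
    refine setIntegral_nonneg measurableSet_Ioo fun θ hθ => ?_
    have hsθ : 0 < Real.sin (2 * θ) := Real.sin_pos_of_pos_of_lt_pi (by linarith [hθ.1]) (by linarith [hθ.2])
    exact mul_nonneg (sq_nonneg _) (Real.rpow_nonneg hsθ.le _)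
  have eT : ∫ p in strip, 2 * p.1 ^ 2 / (1 + p.1) ^ 3 / profileConst α *
      (2 * α / 3 * (1 - 3 * Real.sin p.2 ^ 2) * angularWeight α p.2) *
      Dθ f p.1 p.2 * radialWeight p.1 ^ 2 * Real.sin (2 * p.2) ^ (-gammaExp α) = ∫ p in strip, φ p * ψ p :=
    (setIntegral_congr_fun measurableSet_strip eφψ).symm
  have eY : ∫ p in strip, φ p ^ 2 = Y := setIntegral_congr_fun measurableSet_strip eφ2
  rw [eT]
  rw [eY, hψ2] at hCS
  have hc2 : 4 / profileConst α ^ 2 ≤ 4 / (49 / 50 : ℝ) ^ 2 := by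
    apply div_le_div_of_nonneg_left (by norm_num) (by norm_num)
    exact pow_le_pow_left₀ (by norm_num) hc49 2
  have hψ2le : 4 / profileConst α ^ 2 * ∫ θ in Ioo 0 (π / 2), D θ ^ 2 * Real.sin (2 * θ) ^ (-gammaExp α) ≤ 42 * α := by
    calc 4 / profileConst α ^ 2 * ∫ θ in Ioo 0 (π / 2), D θ ^ 2 * Real.sin (2 * θ) ^ (-gammaExp α)
        ≤ 4 / (49 / 50 : ℝ) ^ 2 * (10 * α) := mul_le_mul hc2 hAng hAng0 (by norm_num)
      _ ≤ 42 * α := by nlinarith [hα]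
  calc (∫ p in strip, φ p * ψ p) ^ 2 ≤ Y * (4 / profileConst α ^ 2 *
        ∫ θ in Ioo 0 (π / 2), D θ ^ 2 * Real.sin (2 * θ) ^ (-gammaExp α)) := hCS
    _ ≤ Y * (42 * α) := mul_le_mul_of_nonneg_left hψ2le hY0
    _ = 42 * α * Y := by ring

/-- **The projector coefficient by parts**: `L₁₂((3/(1+z))D_θf)(0)² ≤ 153·∬(fw)²` (integration by
parts in `θ`: `L₁₂((3/(1+z))D_θf)(0) = −∬(K sin2θ)'·3f/((1+z)z)`, `|(K sin2θ)'| ≤ 18`, Cauchy–Schwarz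
against `3z/(1+z)³`, `∫₀^∞z²/(1+z)⁶ = 1/30`). [cite: Elgindi2021, §6.1, proof of Proposition 6.5 (p. 16 of arXiv:1904.04795)] -/
theorem sq_L12_transport_le_sq_norm :
    L12 (fun z θ => 3 / (1 + z) * Dθ f z θ) 0 ^ 2 ≤ 153 * ∫ p in strip, (f p.1 p.2 * radialWeight p.1) ^ 2 := by
  have hfc : Continuous (uncurry f) := hf.continuous
  have hf0 : ∀ p : ℝ × ℝ, p ∉ tsupport (uncurry f) → f p.1 p.2 = 0 := fun p hp =>
    (image_eq_zero_of_notMem_tsupport hp : uncurry f p = 0)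
  have hD0 : ∀ p : ℝ × ℝ, p ∉ tsupport (uncurry f) → Dθ f p.1 p.2 = 0 := fun p hp =>
    Dθ_eq_zero_of_notMem_tsupport hp
  -- `u = K sin 2θ = 6 sin²θ cos³θ`, `|u'| ≤ 18`
  set u : ℝ → ℝ := fun θ => kernelK θ * Real.sin (2 * θ) with hu
  have hud : ∀ θ, HasDerivAt u (6 * (2 * Real.sin θ * Real.cos θ * Real.cos θ ^ 3 +
      Real.sin θ ^ 2 * (-(3 * Real.cos θ ^ 2 * Real.sin θ)))) θ := by
    intro θ
    have h1 : HasDerivAt (fun x => Real.sin x ^ 2) (2 * Real.sin θ * Real.cos θ) θ :=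
      ((Real.hasDerivAt_sin θ).fun_pow 2).congr_deriv (by norm_num)
    have h2 : HasDerivAt (fun x => Real.cos x ^ 3) (-(3 * Real.cos θ ^ 2 * Real.sin θ)) θ :=
      ((Real.hasDerivAt_cos θ).fun_pow 3).congr_deriv (by norm_num)
    have h := (h1.fun_mul h2).const_mul 6
    have e : u = fun x => 6 * (Real.sin x ^ 2 * Real.cos x ^ 3) := by
      funext x
      simp only [hu, kernelK, Real.sin_two_mul]
      ring
    rw [e]
    exact h
  have huC : ContDiffOn ℝ 1 u (Ioo 0 (π / 2)) := by
    have : ContDiff ℝ 1 u := by simp only [hu, kernelK]; fun_prop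
    exact this.contDiffOn
  have hu'b : ∀ θ, |deriv u θ| ≤ 18 := by
    intro θ
    rw [(hud θ).deriv]
    have e1 : 6 * (2 * Real.sin θ * Real.cos θ * Real.cos θ ^ 3 +
        Real.sin θ ^ 2 * (-(3 * Real.cos θ ^ 2 * Real.sin θ))) =
        (6 * Real.sin θ) * (Real.cos θ ^ 2 * (2 * Real.cos θ ^ 2 - 3 * Real.sin θ ^ 2)) := by ring
    rw [e1, abs_mul, abs_mul, abs_mul]
    have hsc : Real.sin θ ^ 2 + Real.cos θ ^ 2 = 1 := Real.sin_sq_add_cos_sq θ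
    have h1 : |(6 : ℝ)| * |Real.sin θ| ≤ 6 := by
      rw [abs_of_pos (by norm_num : (0 : ℝ) < 6)]
      nlinarith [Real.abs_sin_le_one θ, abs_nonneg (Real.sin θ)]
    have h2 : |Real.cos θ ^ 2| ≤ 1 := by
      rw [abs_of_nonneg (sq_nonneg _)]
      nlinarith [sq_nonneg (Real.sin θ)]
    have h3 : |2 * Real.cos θ ^ 2 - 3 * Real.sin θ ^ 2| ≤ 3 := by
      rw [abs_le]
      constructor <;> nlinarith [sq_nonneg (Real.cos θ), sq_nonneg (Real.sin θ)]
    calc |(6 : ℝ)| * |Real.sin θ| * (|Real.cos θ ^ 2| * |2 * Real.cos θ ^ 2 - 3 * Real.sin θ ^ 2|)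
        ≤ 6 * (1 * 3) := by
          apply mul_le_mul h1 (mul_le_mul h2 h3 (abs_nonneg _) (by norm_num)) (by positivity) (by norm_num)
      _ = 18 := by norm_num
  -- `G = 3f/((1+z)z)`, integration by parts in `θ`
  set G : ℝ × ℝ → ℝ := fun p => 3 / ((1 + p.1) * p.1) * f p.1 p.2 with hG
  have hGon : ContDiffOn ℝ 1 G strip := by
    refine (ContDiffOn.div (by fun_prop) (by fun_prop) fun p hp => ?_).mul (hf.of_le (by norm_num)).contDiffOn
    have : (0 : ℝ) < p.1 := hp.1
    exact mul_ne_zero (by positivity) this.ne'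
  have hG_sub : tsupport G ⊆ tsupport (uncurry f) :=
    tsupport_mul_subset_right (f := fun p : ℝ × ℝ => 3 / ((1 + p.1) * p.1)) (g := uncurry f)
  have hGs : HasCompactSupport G := hs.mul_left
  have hbp := integral_strip_weight_mul_deriv_slice_snd hGon hGs (hG_sub.trans hsub) huC
  -- the left side is `ℓ₀`
  have hgon : ContinuousOn (fun p : ℝ × ℝ => 3 / (1 + p.1) * Dθ f p.1 p.2) strip := by
    refine (ContinuousOn.div continuousOn_const (by fun_prop) fun p hp => ?_).mul (continuous_Dθ (hf.of_le (by norm_num))).continuousOn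
    have : (0 : ℝ) < p.1 := hp.1; positivity
  have hgi : IntegrableOn (l12Integrand fun z θ => 3 / (1 + z) * Dθ f z θ) strip := by
    have hc' : Continuous (l12Integrand fun z θ => 3 / (1 + z) * Dθ f z θ) := by
      refine continuous_of_continuousOn_strip (isClosed_tsupport _) hsub ?_ fun p hp => by simp [hD0 p hp]
      change ContinuousOn (fun p : ℝ × ℝ => 3 / (1 + p.1) * Dθ f p.1 p.2 * kernelK p.2 / p.1) strip
      exact (hgon.mul (continuous_kernelK.comp continuous_snd).continuousOn).div continuousOn_fst
        fun p hp => ne_of_gt hp.1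
    exact (hc'.integrable_of_hasCompactSupport (HasCompactSupport.intro hs fun p hp => by simp [hD0 p hp])).integrableOn
  have hGsl : ∀ p ∈ strip, deriv (fun θ => G (p.1, θ)) p.2 = 3 / ((1 + p.1) * p.1) * dθ f p.1 p.2 := by
    intro p hp
    have hd : DifferentiableAt ℝ (uncurry f) p := (hf.differentiable (by norm_num)) p
    have h := (hasDerivAt_slice_snd hd).const_mul (3 / ((1 + p.1) * p.1))
    rw [dθ_eq_fderiv hd]
    simp only [hG]
    exact h.deriv
  have eL : ∫ p in strip, u p.2 * deriv (fun θ => G (p.1, θ)) p.2 = L12 (fun z θ => 3 / (1 + z) * Dθ f z θ) 0 := by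
    rw [L12_zero_eq_setIntegral hgi]
    refine setIntegral_congr_fun measurableSet_strip fun p hp => ?_
    have hz : (p.1 : ℝ) ≠ 0 := ne_of_gt hp.1
    have hz1 : (1 : ℝ) + p.1 ≠ 0 := by have : (0 : ℝ) < p.1 := hp.1; positivity
    rw [hGsl p hp]
    simp only [hu, l12Integrand_apply, Dθ_eq_mul_dθ]
    field_simp
  -- Cauchy–Schwarz on the right side: `φ₀ = fw`, `ψ₀ = u'·3z/(1+z)³`
  set φ₀ : ℝ × ℝ → ℝ := fun p => f p.1 p.2 * radialWeight p.1 with hφ₀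
  set ψ₀ : ℝ × ℝ → ℝ := fun p => deriv u p.2 * (3 * p.1 / (1 + p.1) ^ 3) with hψ₀
  have eR : ∀ p ∈ strip, deriv u p.2 * G p = φ₀ p * ψ₀ p := by
    intro p hp
    have hz : (0 : ℝ) < p.1 := hp.1
    simp only [hG, hφ₀, hψ₀]
    unfold radialWeight
    field_simp
  have hwon : ContinuousOn (fun p : ℝ × ℝ => radialWeight p.1) strip := by
    unfold radialWeight
    exact ContinuousOn.div (by fun_prop) (by fun_prop) fun p hp => pow_ne_zero 2 (ne_of_gt hp.1)
  have hu'c : Continuous (deriv u) := by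
    have e : deriv u = fun θ => 6 * (2 * Real.sin θ * Real.cos θ * Real.cos θ ^ 3 +
        Real.sin θ ^ 2 * (-(3 * Real.cos θ ^ 2 * Real.sin θ))) := funext fun θ => (hud θ).deriv
    rw [e]
    fun_prop
  have iφψ : IntegrableOn (fun p => φ₀ p * ψ₀ p) strip := by
    have hc' : Continuous fun p => φ₀ p * ψ₀ p := by
      refine continuous_of_continuousOn_strip (isClosed_tsupport _) hsub ?_ fun p hp => by simp [hφ₀, hf0 p hp]
      refine (hfc.continuousOn.mul hwon).mul ((hu'c.comp continuous_snd).continuousOn.mul ?_)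
      exact ContinuousOn.div (by fun_prop) (by fun_prop) fun p hp => by have : (0 : ℝ) < p.1 := hp.1; positivity
    exact (hc'.integrable_of_hasCompactSupport (HasCompactSupport.intro hs fun p hp => by
      simp [hφ₀, hf0 p hp])).integrableOn
  have iφ2 : IntegrableOn (fun p => φ₀ p ^ 2) strip := by
    have e : (fun p : ℝ × ℝ => φ₀ p ^ 2) = fun p => f p.1 p.2 * (f p.1 p.2 * radialWeight p.1 ^ 2) := by
      funext p; simp only [hφ₀]; ring
    rw [e]
    refine (Continuous.integrable_of_hasCompactSupport ?_ hs.mul_right).integrableOn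
    exact continuous_of_continuousOn_strip (isClosed_tsupport _) hsub
      (hfc.continuousOn.mul (hfc.continuousOn.mul (hwon.pow 2))) fun p hp => by simp [hf0 p hp]
  have eψ2 : ∀ p ∈ strip, ψ₀ p ^ 2 = (9 * (p.1 ^ 2 / (1 + p.1) ^ 6)) * deriv u p.2 ^ 2 := by
    intro p hp
    have hz : (0 : ℝ) < p.1 := hp.1
    simp only [hψ₀]
    field_simp
    ring
  have iz : Integrable (fun z : ℝ => 9 * (z ^ 2 / (1 + z) ^ 6)) (volume.restrict (Ioi 0)) :=
    integrableOn_sq_div_one_add_pow_six.const_mul _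
  have iθ : Integrable (fun θ : ℝ => deriv u θ ^ 2) (volume.restrict (Ioo 0 (π / 2))) :=
    ((hu'c.pow 2).integrableOn_Icc (a := 0) (b := π / 2)).mono_set Ioo_subset_Icc_self
  have iψ2 : IntegrableOn (fun p => ψ₀ p ^ 2) strip := by
    have h := iz.mul_prod iθ
    rw [← volume_restrict_strip] at h
    exact IntegrableOn.congr_fun h (fun p hp => (eψ2 p hp).symm) measurableSet_strip
  have hCS := sq_integral_mul_le iφ2 iψ2 iφψ
  have hψ2 : ∫ p in strip, ψ₀ p ^ 2 = (9 * (1 / 30)) * ∫ θ in Ioo 0 (π / 2), deriv u θ ^ 2 := by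
    rw [setIntegral_congr_fun measurableSet_strip eψ2, volume_restrict_strip,
      integral_prod_mul (f := fun z : ℝ => 9 * (z ^ 2 / (1 + z) ^ 6)) (g := fun θ : ℝ => deriv u θ ^ 2),
      integral_const_mul, integral_Ioi_sq_div_one_add_pow_six]
  have hθle : ∫ θ in Ioo 0 (π / 2), deriv u θ ^ 2 ≤ 324 * (π / 2) := by
    have hI' : IntegrableOn (fun _ : ℝ => (324 : ℝ)) (Ioo 0 (π / 2)) :=
      (continuous_const.integrableOn_Icc (a := 0) (b := π / 2)).mono_set Ioo_subset_Icc_self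
    calc ∫ θ in Ioo 0 (π / 2), deriv u θ ^ 2 ≤ ∫ θ in Ioo 0 (π / 2), (324 : ℝ) := by
          refine setIntegral_mono_on iθ hI' measurableSet_Ioo fun θ _ => ?_
          have h := hu'b θ
          rw [abs_le] at h
          nlinarith
      _ = 324 * (π / 2) := by
          rw [setIntegral_const, Real.volume_real_Ioo_of_le (by positivity), smul_eq_mul, sub_zero]
          ring
  have hA0 : 0 ≤ ∫ p in strip, φ₀ p ^ 2 := integral_nonneg fun p => sq_nonneg _
  have eA : ∫ p in strip, φ₀ p ^ 2 = ∫ p in strip, (f p.1 p.2 * radialWeight p.1) ^ 2 := rfl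
  -- assemble: `ℓ₀ = ∬ u ∂_θG = −∬ u'G = −∬ φ₀ψ₀`
  have eℓ : L12 (fun z θ => 3 / (1 + z) * Dθ f z θ) 0 = -∫ p in strip, φ₀ p * ψ₀ p := by
    rw [← eL, hbp, setIntegral_congr_fun measurableSet_strip eR]
  rw [eℓ, neg_sq]
  have hπ := Real.pi_lt_d4
  calc (∫ p in strip, φ₀ p * ψ₀ p) ^ 2 ≤ (∫ p in strip, φ₀ p ^ 2) * ∫ p in strip, ψ₀ p ^ 2 := hCS
    _ ≤ (∫ p in strip, φ₀ p ^ 2) * (153 : ℝ) := by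
        refine mul_le_mul_of_nonneg_left ?_ hA0
        rw [hψ2]
        nlinarith [hθle]
    _ = 153 * ∫ p in strip, (f p.1 p.2 * radialWeight p.1) ^ 2 := by rw [eA]; ring

/-- **The splitting of the pairing** `∬ D_θ(𝓛_Γ^T f)·D_θf·w²ρ = T₁ − T₂ − T₄ + ℓ₀J₃`. [folklore] -/
theorem integral_Dθ_opLΓT_pairing_eq (hα : 0 ≤ α) :
    ∫ p in strip, Dθ (opLΓT α f) p.1 p.2 * Dθ f p.1 p.2 * radialWeight p.1 ^ 2 *
        Real.sin (2 * p.2) ^ (-gammaExp α) =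
      (∫ p in strip, opL (Dθ f) p.1 p.2 * Dθ f p.1 p.2 * radialWeight p.1 ^ 2 *
          Real.sin (2 * p.2) ^ (-gammaExp α))
      - (∫ p in strip, 2 * p.1 / (profileConst α * (1 + p.1) ^ 2) * L12 f p.1 *
          (2 * α / 3 * (1 - 3 * Real.sin p.2 ^ 2) * angularWeight α p.2) *
          Dθ f p.1 p.2 * radialWeight p.1 ^ 2 * Real.sin (2 * p.2) ^ (-gammaExp α))
      - (∫ p in strip, 3 / (1 + p.1) * Dθ (Dθ f) p.1 p.2 * Dθ f p.1 p.2 * radialWeight p.1 ^ 2 *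
          Real.sin (2 * p.2) ^ (-gammaExp α))
      + L12 (fun z θ => 3 / (1 + z) * Dθ f z θ) 0 *
        ∫ p in strip, 2 * p.1 ^ 2 / (1 + p.1) ^ 3 / profileConst α *
          (2 * α / 3 * (1 - 3 * Real.sin p.2 ^ 2) * angularWeight α p.2) *
          Dθ f p.1 p.2 * radialWeight p.1 ^ 2 * Real.sin (2 * p.2) ^ (-gammaExp α) := by
  have hcpos : 0 < profileConst α := profileConst_pos hα
  have hΓc : Continuous (angularWeight α) := continuous_angularWeight hα
  have hLc : Continuous (L12 f) := continuous_L12 hf.continuous hs hsub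
  have hgC : ContDiff ℝ 1 (uncurry (Dθ f)) := contDiff_Dθ (n := 1) hf hsub
  have hDc : Continuous fun θ => 2 * α / 3 * (1 - 3 * Real.sin θ ^ 2) * angularWeight α θ :=
    (continuous_const.mul (by fun_prop)).mul hΓc
  -- continuity on the strip of the four coefficients
  have hwon : ContinuousOn (fun p : ℝ × ℝ => radialWeight p.1) strip := by
    unfold radialWeight
    exact ContinuousOn.div (by fun_prop) (by fun_prop) fun p hp => pow_ne_zero 2 (ne_of_gt hp.1)
  have c1 : ContinuousOn (fun p : ℝ × ℝ => opL (Dθ f) p.1 p.2) strip := by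
    have hg1 : ContDiffOn ℝ 1 (uncurry (Dθ f)) strip := hgC.contDiffOn
    have hdz : ContinuousOn (fun p : ℝ × ℝ => Dz (Dθ f) p.1 p.2) strip :=
      (contDiffOn_Dz (n := 0) hg1).continuousOn
    have hgon : ContinuousOn (fun p : ℝ × ℝ => Dθ f p.1 p.2) strip := hgC.continuous.continuousOn
    have h3 : ContinuousOn (fun p : ℝ × ℝ => 2 * Dθ f p.1 p.2 / (1 + p.1)) strip :=
      (continuousOn_const.mul hgon).div (by fun_prop) fun p hp => by
        have : (0 : ℝ) < p.1 := hp.1; positivity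
    exact ((hgon.add hdz).sub h3).congr fun p _ => by simp only [Pi.add_apply, Pi.sub_apply, opL_apply]
  have c2 : ContinuousOn (fun p : ℝ × ℝ => 2 * p.1 / (profileConst α * (1 + p.1) ^ 2) * L12 f p.1 *
      (2 * α / 3 * (1 - 3 * Real.sin p.2 ^ 2) * angularWeight α p.2)) strip := by
    refine ((ContinuousOn.div (by fun_prop) (by fun_prop) fun p hp => ?_).mul
      (hLc.comp continuous_fst).continuousOn).mul (hDc.comp continuous_snd).continuousOn
    have : (0 : ℝ) < p.1 := hp.1
    exact mul_ne_zero hcpos.ne' (by positivity)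
  have c3 : ContinuousOn (fun p : ℝ × ℝ => 3 / (1 + p.1) * Dθ (Dθ f) p.1 p.2) strip := by
    have hDD : ContinuousOn (fun p : ℝ × ℝ => Dθ (Dθ f) p.1 p.2) strip :=
      (contDiffOn_Dθ (n := 0) hgC.contDiffOn).continuousOn
    refine (ContinuousOn.div continuousOn_const (by fun_prop) fun p hp => ?_).mul hDD
    have : (0 : ℝ) < p.1 := hp.1; positivity
  have c4 : ContinuousOn (fun p : ℝ × ℝ => 2 * p.1 ^ 2 / (1 + p.1) ^ 3 / profileConst α *
      (2 * α / 3 * (1 - 3 * Real.sin p.2 ^ 2) * angularWeight α p.2)) strip := by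
    refine (ContinuousOn.div_const (ContinuousOn.div (by fun_prop) (by fun_prop) fun p hp => ?_) _).mul
      (hDc.comp continuous_snd).continuousOn
    have : (0 : ℝ) < p.1 := hp.1; positivity
  have i1 := integrableOn_mul_Dθ_weight (α := α) hf hs hsub c1
  have i2 := integrableOn_mul_Dθ_weight (α := α) hf hs hsub c2
  have i3 := integrableOn_mul_Dθ_weight (α := α) hf hs hsub c3
  have i4 := integrableOn_mul_Dθ_weight (α := α) hf hs hsub c4
  have hsplit : ∀ p ∈ strip, Dθ (opLΓT α f) p.1 p.2 * Dθ f p.1 p.2 * radialWeight p.1 ^ 2 *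
      Real.sin (2 * p.2) ^ (-gammaExp α) =
      opL (Dθ f) p.1 p.2 * Dθ f p.1 p.2 * radialWeight p.1 ^ 2 * Real.sin (2 * p.2) ^ (-gammaExp α)
      - 2 * p.1 / (profileConst α * (1 + p.1) ^ 2) * L12 f p.1 *
          (2 * α / 3 * (1 - 3 * Real.sin p.2 ^ 2) * angularWeight α p.2) *
          Dθ f p.1 p.2 * radialWeight p.1 ^ 2 * Real.sin (2 * p.2) ^ (-gammaExp α)
      - 3 / (1 + p.1) * Dθ (Dθ f) p.1 p.2 * Dθ f p.1 p.2 * radialWeight p.1 ^ 2 *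
          Real.sin (2 * p.2) ^ (-gammaExp α)
      + L12 (fun z θ => 3 / (1 + z) * Dθ f z θ) 0 *
          (2 * p.1 ^ 2 / (1 + p.1) ^ 3 / profileConst α *
            (2 * α / 3 * (1 - 3 * Real.sin p.2 ^ 2) * angularWeight α p.2) *
            Dθ f p.1 p.2 * radialWeight p.1 ^ 2 * Real.sin (2 * p.2) ^ (-gammaExp α)) := by
    intro p hp
    rw [Dθ_opLΓT (hf.contDiffOn) hp]
    ring
  rw [setIntegral_congr_fun measurableSet_strip hsplit, integral_add, integral_sub, integral_sub,
    integral_const_mul]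
  all_goals first
    | exact i1
    | exact i2
    | exact i3
    | exact i1.sub i2
    | exact (i1.sub i2).sub i3
    | exact (i4.const_mul _)

end Prop65

/-! ### Proposition 6.5 -/

/-- **Coercivity of `𝓛_Γ^T` with one `θ`-derivative** (Elgindi 2021, Proposition 6.5:
"`((D_θ𝓛_Γ^T(f)), (D_θf)w²/sin(2θ)^γ)_{L²} ≥ (¼ − α)|(D_θf)w/√(sin(2θ)^γ)|²_{L²} − 10⁷α|fw|²_{L²}`"),
for `0 < α ≤ 1/200` and `f ∈ C²` compactly supported inside the open quarter strip with
`L₁₂(f)(0) = 0`. See the module docstring for the vendored chain of estimates. [cite: Elgindi2021, §6.1 Proposition 6.5 (p. 16 of arXiv:1904.04795)] -/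
theorem thetaDerivativeCoercivity {α : ℝ} (hα : 0 < α) (hα' : α ≤ 1 / 200) {f : ℝ → ℝ → ℝ}
    (hf : ContDiff ℝ 2 (uncurry f)) (hs : HasCompactSupport (uncurry f))
    (hsub : tsupport (uncurry f) ⊆ strip) (hL0 : L12 f 0 = 0) :
    (1 / 4 - α) * (∫ p in strip, (Dθ f p.1 p.2 * radialWeight p.1) ^ 2 * Real.sin (2 * p.2) ^ (-gammaExp α)) -
        10 ^ 7 * α * ∫ p in strip, (f p.1 p.2 * radialWeight p.1) ^ 2 ≤
      ∫ p in strip, Dθ (opLΓT α f) p.1 p.2 * Dθ f p.1 p.2 * radialWeight p.1 ^ 2 *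
        Real.sin (2 * p.2) ^ (-gammaExp α) := by
  rw [integral_Dθ_opLΓT_pairing_eq hf hs hsub hα.le]
  set Y : ℝ := ∫ p in strip, (Dθ f p.1 p.2 * radialWeight p.1) ^ 2 * Real.sin (2 * p.2) ^ (-gammaExp α) with hY
  set A : ℝ := ∫ p in strip, (f p.1 p.2 * radialWeight p.1) ^ 2 with hA
  set T1 : ℝ := ∫ p in strip, opL (Dθ f) p.1 p.2 * Dθ f p.1 p.2 * radialWeight p.1 ^ 2 *
    Real.sin (2 * p.2) ^ (-gammaExp α) with hT1
  set T2 : ℝ := ∫ p in strip, 2 * p.1 / (profileConst α * (1 + p.1) ^ 2) * L12 f p.1 *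
    (2 * α / 3 * (1 - 3 * Real.sin p.2 ^ 2) * angularWeight α p.2) *
    Dθ f p.1 p.2 * radialWeight p.1 ^ 2 * Real.sin (2 * p.2) ^ (-gammaExp α) with hT2
  set T4 : ℝ := ∫ p in strip, 3 / (1 + p.1) * Dθ (Dθ f) p.1 p.2 * Dθ f p.1 p.2 * radialWeight p.1 ^ 2 *
    Real.sin (2 * p.2) ^ (-gammaExp α) with hT4
  set ℓ₀ : ℝ := L12 (fun z θ => 3 / (1 + z) * Dθ f z θ) 0 with hℓ₀
  set J3 : ℝ := ∫ p in strip, 2 * p.1 ^ 2 / (1 + p.1) ^ 3 / profileConst α *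
    (2 * α / 3 * (1 - 3 * Real.sin p.2 ^ 2) * angularWeight α p.2) *
    Dθ f p.1 p.2 * radialWeight p.1 ^ 2 * Real.sin (2 * p.2) ^ (-gammaExp α) with hJ3
  have h1 : T1 = (1 / 2) * Y := integral_opL_Dθ_energy (α := α) hf hs hsub
  have h4 : -(3 * α / 10) * Y ≤ -T4 := integral_transport_Dθ_ge hα.le hf hs hsub
  have h2 : T2 ^ 2 ≤ 148 * α * A * Y := sq_T2_le hf hs hsub hα hα' hL0
  have h3a : J3 ^ 2 ≤ 42 * α * Y := sq_J3_le hf hs hsub hα hα'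
  have h3b : ℓ₀ ^ 2 ≤ 153 * A := sq_L12_transport_le_sq_norm hf hs hsub
  have hA0 : 0 ≤ A := integral_nonneg fun p => sq_nonneg _
  have hY0 : 0 ≤ Y := by
    simp only [hY]
    refine setIntegral_nonneg measurableSet_strip fun p hp => ?_
    have hsθ : 0 < Real.sin (2 * p.2) := Real.sin_pos_of_pos_of_lt_pi (by linarith [hp.2.1]) (by linarith [hp.2.2])
    exact mul_nonneg (sq_nonneg _) (Real.rpow_nonneg hsθ.le _)
  -- `|T2| ≤ Y/8 + 296 α A`, `|ℓ₀ J3| ≤ Y/8 + 5712 α A`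
  have hT2 : T2 ≤ Y / 8 + 2 * 148 * α * A := by
    by_contra hcon
    rw [not_le] at hcon
    have hB : 0 ≤ Y / 8 + 2 * 148 * α * A := by positivity
    have h' : (Y / 8 + 2 * 148 * α * A) ^ 2 < T2 ^ 2 := pow_lt_pow_left₀ hcon hB two_ne_zero
    nlinarith [sq_nonneg (Y / 8 - 2 * 148 * α * A), h2, h']
  have h3 : (ℓ₀ * J3) ^ 2 ≤ (153 * 42) * α * A * Y := by
    rw [mul_pow]
    calc ℓ₀ ^ 2 * J3 ^ 2 ≤ (153 * A) * (42 * α * Y) :=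
          mul_le_mul h3b h3a (sq_nonneg _) (by positivity)
      _ = (153 * 42) * α * A * Y := by ring
  have hT3 : -(ℓ₀ * J3) ≤ Y / 8 + 2 * (153 * 42) * α * A := by
    by_contra hcon
    rw [not_le] at hcon
    have hB : 0 ≤ Y / 8 + 2 * (153 * 42) * α * A := by positivity
    have h' : (Y / 8 + 2 * (153 * 42) * α * A) ^ 2 < (-(ℓ₀ * J3)) ^ 2 := pow_lt_pow_left₀ hcon hB two_ne_zero
    rw [neg_sq] at h'
    nlinarith [sq_nonneg (Y / 8 - 2 * (153 * 42) * α * A), h3, h']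
  nlinarith [h1, h4, hT2, hT3, hA0, hY0, hα, hα']

end Elgindi

end Literature.Analysis.FluidPDE
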